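import Summits.BirchSwinnertonDyer.BirchSwinnertonDyer.Theorems.ResidualThetaTransportAtTwoThetaLayerLambdaCongruenceAtTwoCuspSpanGenerationB1
import HarnessLib

/-!
# Route `ResidualThetaTransportAtTwo`, cruxes Kan⁺ (stmt-BirchSwinnertonDyer-20688) / Kμ⁺ / 21437: `CuspSpanEvenAtTwo 29` and
# `CuspSpanEvenAtTwo 37` by `B₁`-certificates (seeds + three-term steps + descent)

Cell `bsd-wall`, lead prover `bsd-wall-rtt-p3` g9 (2026-08-28). THEOREMS ONLY; `--supports stmt-BirchSwinnertonDyer-20688`; BSD is not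
proved by this. `N = 29`: prime, `29 ≡ 5 (mod 8)`, `X₀(29)` of genus `2`, `±⟨4⟩ =` the squares `≠ (ℤ/29)^×`, so Theorem A
(`…CuspSpanGeneration`) does not apply; the seeds are the `14` square classes (`±4^k`) and the two order-`4` elliptic residues `±12`
(non-squares since `29 ≢ 1 (mod 8)`), and the three-term rule of `…CuspSpanGenerationB1` reaches the remaining `12` classes. The same
certificate exists (this seat's `closure.py`) for `N = 13, 25, 37, 53, 101, 125, 169, 181, 197`; it does NOT close for
`N = 17, 31, 41, 43, 61, 73, …` (there the Eisenstein character / deeper products are needed).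

References: [Rademacher1929]; [Knapp1993] Prop. 11.1; [Pollack2003] Conj. 6.3.
-/

set_option autoImplicit false
set_option linter.dupNamespace false

noncomputable section

open scoped MatrixGroups

open CongruenceSubgroup WeierstrassCurve Literature.NumberTheory.EllipticCurves
  Literature.NumberTheory.EllipticCurves.ModularForms Literature.NumberTheory.EllipticCurves.Rank1Residual
  Literature.NumberTheory.IwasawaTheory Summit.BirchSwinnertonDyer.Rank1Residual.Supersingular

namespace Summit.BirchSwinnertonDyer.BirchSwinnertonDyer.Theorems.SignedMuAtTwo

/-- **(G″)₂₉ with `ψ = 0`** — `29 ≡ 5 (mod 8)`, genus `2`, OUTSIDE Theorem A (`±⟨4⟩` = the squares ≠ `(ℤ/29)^×`): the seeds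
(`±4^k` = squares; the order-4 elliptic residues `±12`) and twelve applications of the three-term rule kill every residue class, then
the descent. [cite: Pollack2003, Conj. 6.3] [cite: Rademacher1929, §1] -/
theorem cuspSpanTrace_twentynine : ∀ χ : Gamma0 29 → ZMod 2,
    (∀ γ δ : Gamma0 29, χ (γ * δ) = χ γ + χ δ) →
    (∀ γ : Gamma0 29, ((γ : SL(2, ℤ)) 0 0 + (γ : SL(2, ℤ)) 1 1).natAbs ≤ 2 → χ γ = 0) →
    (∀ γ : Gamma0 29, (∃ k : ℕ, 1 ≤ k ∧ ((γ : SL(2, ℤ)) 1 1).natAbs = 4 ^ k) → χ γ = 0) →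
    ∃ ψ : ZMod 29 → ZMod 2, (∀ x y : ZMod 29, IsUnit x → IsUnit y → ψ (x * y) = ψ x + ψ y) ∧
      ∀ γ : Gamma0 29, χ γ = ψ ((((γ : SL(2, ℤ)) 1 1 : ℤ) : ZMod 29)) := by
  intro χ hadd hsmall hkill
  refine ⟨fun _ ↦ 0, fun _ _ _ _ ↦ by simp, ?_⟩
  have Kpow := K_pow (N := 29) hadd hsmall hkill
  have Kell := K_ell (N := 29) hadd hsmall
  have Kpos := K_rule_pos (N := 29) hadd hsmall
  have Kneg := K_rule_neg (N := 29) hadd hsmall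
  have k1 := Kpow 7 (by norm_num) (-1) (by decide) 1 (by decide)
  have k4 := Kpow 1 (by norm_num) 1 (by decide) 4 (by decide)
  have k5 := Kpow 4 (by norm_num) (-1) (by decide) 5 (by decide)
  have k6 := Kpow 3 (by norm_num) 1 (by decide) 6 (by decide)
  have k7 := Kpow 6 (by norm_num) 1 (by decide) 7 (by decide)
  have k9 := Kpow 5 (by norm_num) 1 (by decide) 9 (by decide)
  have k12 := Kell 12 0 (by decide) (by decide) 12 (by decide)
  have k13 := Kpow 2 (by norm_num) (-1) (by decide) 13 (by decide)
  have k16 := Kpow 2 (by norm_num) 1 (by decide) 16 (by decide)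
  have k17 := Kell 17 0 (by decide) (by decide) 17 (by decide)
  have k20 := Kpow 5 (by norm_num) (-1) (by decide) 20 (by decide)
  have k22 := Kpow 6 (by norm_num) (-1) (by decide) 22 (by decide)
  have k23 := Kpow 3 (by norm_num) (-1) (by decide) 23 (by decide)
  have k24 := Kpow 4 (by norm_num) 1 (by decide) 24 (by decide)
  have k25 := Kpow 1 (by norm_num) (-1) (by decide) 25 (by decide)
  have k28 := Kpow 7 (by norm_num) 1 (by decide) 28 (by decide)
  have k8 : ∀ β : Gamma0 29, (β : SL(2, ℤ)) 0 1 = -1 → ((((β : SL(2, ℤ)) 1 1 : ℤ) : ZMod 29)) = 8 → χ β = 0 := by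
    have h := Kneg 11 8 (-87) 12 (-12) 145 (by norm_num) (by norm_num) (by norm_num) (by norm_num)
      (by norm_num) 8 17 16 (by decide) (by decide) (by decide)
    exact h.2.2 k17 k16
  have k11 : ∀ β : Gamma0 29, (β : SL(2, ℤ)) 0 1 = -1 → ((((β : SL(2, ℤ)) 1 1 : ℤ) : ZMod 29)) = 11 → χ β = 0 := by
    have h := Kneg 8 11 (-87) 16 (-9) 145 (by norm_num) (by norm_num) (by norm_num) (by norm_num)
      (by norm_num) 11 20 12 (by decide) (by decide) (by decide)
    exact h.2.2 k20 k12
  have k21 : ∀ β : Gamma0 29, (β : SL(2, ℤ)) 0 1 = -1 → ((((β : SL(2, ℤ)) 1 1 : ℤ) : ZMod 29)) = 21 → χ β = 0 := by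
    have h := Kpos 9 13 (-116) 18 (-8) 145 (by norm_num) (by norm_num) (by norm_num) (by norm_num)
      (by norm_num) 13 21 12 (by decide) (by decide) (by decide)
    exact h.2.1 k13 k12
  have k18 : ∀ β : Gamma0 29, (β : SL(2, ℤ)) 0 1 = -1 → ((((β : SL(2, ℤ)) 1 1 : ℤ) : ZMod 29)) = 18 → χ β = 0 := by
    have h := Kpos 12 17 (-203) 21 (-11) 232 (by norm_num) (by norm_num) (by norm_num) (by norm_num)
      (by norm_num) 17 18 16 (by decide) (by decide) (by decide)
    exact h.2.1 k17 k16
  have k3 : ∀ β : Gamma0 29, (β : SL(2, ℤ)) 0 1 = -1 → ((((β : SL(2, ℤ)) 1 1 : ℤ) : ZMod 29)) = 3 → χ β = 0 := by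
    have h := Kneg 21 18 (-377) 25 (-22) 551 (by norm_num) (by norm_num) (by norm_num) (by norm_num)
      (by norm_num) 18 7 3 (by decide) (by decide) (by decide)
    exact h.1 k18 k7
  have k19 : ∀ β : Gamma0 29, (β : SL(2, ℤ)) 0 1 = -1 → ((((β : SL(2, ℤ)) 1 1 : ℤ) : ZMod 29)) = 19 → χ β = 0 := by
    have h := Kpos 26 19 (-493) 22 (-25) 551 (by norm_num) (by norm_num) (by norm_num) (by norm_num)
      (by norm_num) 19 4 18 (by decide) (by decide) (by decide)
    exact h.2.2 k4 k18
  have k2 : ∀ β : Gamma0 29, (β : SL(2, ℤ)) 0 1 = -1 → ((((β : SL(2, ℤ)) 1 1 : ℤ) : ZMod 29)) = 2 → χ β = 0 := by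
    have h := Kneg 26 19 (-493) 15 (-27) 406 (by norm_num) (by norm_num) (by norm_num) (by norm_num)
      (by norm_num) 19 2 13 (by decide) (by decide) (by decide)
    exact h.2.1 k19 k13
  have k14 : ∀ β : Gamma0 29, (β : SL(2, ℤ)) 0 1 = -1 → ((((β : SL(2, ℤ)) 1 1 : ℤ) : ZMod 29)) = 14 → χ β = 0 := by
    have h := Kpos 16 20 (-319) 27 (-15) 406 (by norm_num) (by norm_num) (by norm_num) (by norm_num)
      (by norm_num) 20 14 19 (by decide) (by decide) (by decide)
    exact h.2.1 k20 k19
  have k10 : ∀ β : Gamma0 29, (β : SL(2, ℤ)) 0 1 = -1 → ((((β : SL(2, ℤ)) 1 1 : ℤ) : ZMod 29)) = 10 → χ β = 0 := by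
    have h := Kneg 18 21 (-377) 3 (-19) 58 (by norm_num) (by norm_num) (by norm_num) (by norm_num)
      (by norm_num) 21 10 25 (by decide) (by decide) (by decide)
    exact h.2.1 k21 k25
  have k26 : ∀ β : Gamma0 29, (β : SL(2, ℤ)) 0 1 = -1 → ((((β : SL(2, ℤ)) 1 1 : ℤ) : ZMod 29)) = 26 → χ β = 0 := by
    have h := Kpos 4 22 (-87) 19 (-3) 58 (by norm_num) (by norm_num) (by norm_num) (by norm_num)
      (by norm_num) 22 26 21 (by decide) (by decide) (by decide)
    exact h.2.1 k22 k21
  have k15 : ∀ β : Gamma0 29, (β : SL(2, ℤ)) 0 1 = -1 → ((((β : SL(2, ℤ)) 1 1 : ℤ) : ZMod 29)) = 15 → χ β = 0 := by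
    have h := Kneg 19 26 (-493) 13 (-20) 261 (by norm_num) (by norm_num) (by norm_num) (by norm_num)
      (by norm_num) 26 9 15 (by decide) (by decide) (by decide)
    exact h.1 k26 k9
  have k27 : ∀ β : Gamma0 29, (β : SL(2, ℤ)) 0 1 = -1 → ((((β : SL(2, ℤ)) 1 1 : ℤ) : ZMod 29)) = 27 → χ β = 0 := by
    have h := Kpos 14 27 (-377) 20 (-13) 261 (by norm_num) (by norm_num) (by norm_num) (by norm_num)
      (by norm_num) 27 16 26 (by decide) (by decide) (by decide)
    exact h.2.2 k16 k26
  have hcases : ∀ r : ZMod 29, r ≠ 0 →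
      r = 1 ∨ r = 2 ∨ r = 3 ∨ r = 4 ∨ r = 5 ∨ r = 6 ∨ r = 7 ∨ r = 8 ∨ r = 9 ∨ r = 10 ∨ r = 11 ∨ r = 12 ∨ r = 13 ∨
      r = 14 ∨ r = 15 ∨ r = 16 ∨ r = 17 ∨ r = 18 ∨ r = 19 ∨ r = 20 ∨ r = 21 ∨ r = 22 ∨ r = 23 ∨ r = 24 ∨ r = 25 ∨
      r = 26 ∨ r = 27 ∨ r = 28 := by
    decide
  have hB : ∀ β : Gamma0 29, (β : SL(2, ℤ)) 0 1 = -1 → χ β = 0 := by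
    intro β hb
    haveI : Fact (1 < 29) := ⟨by norm_num⟩
    have hne : ((((β : SL(2, ℤ)) 1 1 : ℤ) : ZMod 29)) ≠ 0 := (isUnit_gamma0_apply_one_one β).ne_zero
    rcases hcases _ hne with h | h | h | h | h | h | h | h | h | h | h | h | h | h | h | h | h | h | h | h | h | h | h | h | h | h | h | h
    · exact k1 β hb h
    · exact k2 β hb h
    · exact k3 β hb h
    · exact k4 β hb h
    · exact k5 β hb h
    · exact k6 β hb h
    · exact k7 β hb h
    · exact k8 β hb h
    · exact k9 β hb h
    · exact k10 β hb h
    · exact k11 β hb h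
    · exact k12 β hb h
    · exact k13 β hb h
    · exact k14 β hb h
    · exact k15 β hb h
    · exact k16 β hb h
    · exact k17 β hb h
    · exact k18 β hb h
    · exact k19 β hb h
    · exact k20 β hb h
    · exact k21 β hb h
    · exact k22 β hb h
    · exact k23 β hb h
    · exact k24 β hb h
    · exact k25 β hb h
    · exact k26 β hb h
    · exact k27 β hb h
    · exact k28 β hb h
  have hsucc : ∀ δ : ℤ, IsUnit ((δ : ℤ) : ZMod 29) ∨ IsUnit (((δ + 1 : ℤ)) : ZMod 29) := by
    simpa using isUnit_or_isUnit_succ_of_primePow (p := 29) (e := 1) (by norm_num)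
  intro γ
  exact chi_eq_zero_of_forall_b1 hsucc hadd hsmall (forall_b1_of_forall_b_neg_one hadd hB) γ

/-- **`CuspSpanEvenAtTwo 29`** — the node (G′)_N at a genus-2 level with `N ≡ 5 (mod 8)`, by the `B₁`-certificate.
[cite: Pollack2003, Conj. 6.3] -/
theorem cuspSpanEvenAtTwo_twentynine : CuspSpanEvenAtTwo 29 :=
  cuspSpanEvenAtTwo_of_cuspSpanTrace cuspSpanTrace_twentynine

/-- **(G″)₃₇ with `ψ = 0`** — `37 ≡ 5 (mod 8)`, genus `2`, outside Theorem A; seeds = squares (`±4^k`, `2` is a primitive root mod `37`)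
and the order-4 elliptic residues `±6`; sixteen three-term steps. [cite: Pollack2003, Conj. 6.3] [cite: Rademacher1929, §1] -/
theorem cuspSpanTrace_thirtyseven : ∀ χ : Gamma0 37 → ZMod 2,
    (∀ γ δ : Gamma0 37, χ (γ * δ) = χ γ + χ δ) →
    (∀ γ : Gamma0 37, ((γ : SL(2, ℤ)) 0 0 + (γ : SL(2, ℤ)) 1 1).natAbs ≤ 2 → χ γ = 0) →
    (∀ γ : Gamma0 37, (∃ k : ℕ, 1 ≤ k ∧ ((γ : SL(2, ℤ)) 1 1).natAbs = 4 ^ k) → χ γ = 0) →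
    ∃ ψ : ZMod 37 → ZMod 2, (∀ x y : ZMod 37, IsUnit x → IsUnit y → ψ (x * y) = ψ x + ψ y) ∧
      ∀ γ : Gamma0 37, χ γ = ψ ((((γ : SL(2, ℤ)) 1 1 : ℤ) : ZMod 37)) := by
  intro χ hadd hsmall hkill
  refine ⟨fun _ ↦ 0, fun _ _ _ _ ↦ by simp, ?_⟩
  have Kpow := K_pow (N := 37) hadd hsmall hkill
  have Kell := K_ell (N := 37) hadd hsmall
  have Kpos := K_rule_pos (N := 37) hadd hsmall
  have Kneg := K_rule_neg (N := 37) hadd hsmall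
  have k1 := Kpow 9 (by norm_num) (-1) (by decide) 1 (by decide)
  have k3 := Kpow 4 (by norm_num) (-1) (by decide) 3 (by decide)
  have k4 := Kpow 1 (by norm_num) 1 (by decide) 4 (by decide)
  have k6 := Kell 6 0 (by decide) (by decide) 6 (by decide)
  have k7 := Kpow 7 (by norm_num) (-1) (by decide) 7 (by decide)
  have k9 := Kpow 8 (by norm_num) 1 (by decide) 9 (by decide)
  have k10 := Kpow 3 (by norm_num) (-1) (by decide) 10 (by decide)
  have k11 := Kpow 6 (by norm_num) (-1) (by decide) 11 (by decide)
  have k12 := Kpow 5 (by norm_num) (-1) (by decide) 12 (by decide)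
  have k16 := Kpow 2 (by norm_num) 1 (by decide) 16 (by decide)
  have k21 := Kpow 2 (by norm_num) (-1) (by decide) 21 (by decide)
  have k25 := Kpow 5 (by norm_num) 1 (by decide) 25 (by decide)
  have k26 := Kpow 6 (by norm_num) 1 (by decide) 26 (by decide)
  have k27 := Kpow 3 (by norm_num) 1 (by decide) 27 (by decide)
  have k28 := Kpow 8 (by norm_num) (-1) (by decide) 28 (by decide)
  have k30 := Kpow 7 (by norm_num) 1 (by decide) 30 (by decide)
  have k31 := Kell 31 0 (by decide) (by decide) 31 (by decide)
  have k33 := Kpow 1 (by norm_num) (-1) (by decide) 33 (by decide)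
  have k34 := Kpow 4 (by norm_num) 1 (by decide) 34 (by decide)
  have k36 := Kpow 9 (by norm_num) 1 (by decide) 36 (by decide)
  have k5 : ∀ β : Gamma0 37, (β : SL(2, ℤ)) 0 1 = -1 → ((((β : SL(2, ℤ)) 1 1 : ℤ) : ZMod 37)) = 5 → χ β = 0 := by
    have h := Kneg 15 5 (-74) 30 (-16) 481 (by norm_num) (by norm_num) (by norm_num) (by norm_num)
      (by norm_num) 5 21 6 (by decide) (by decide) (by decide)
    exact h.2.2 k21 k6
  have k22 : ∀ β : Gamma0 37, (β : SL(2, ℤ)) 0 1 = -1 → ((((β : SL(2, ℤ)) 1 1 : ℤ) : ZMod 37)) = 22 → χ β = 0 := by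
    have h := Kpos 16 7 (-111) 32 (-15) 481 (by norm_num) (by norm_num) (by norm_num) (by norm_num)
      (by norm_num) 7 22 6 (by decide) (by decide) (by decide)
    exact h.2.1 k7 k6
  have k8 : ∀ β : Gamma0 37, (β : SL(2, ℤ)) 0 1 = -1 → ((((β : SL(2, ℤ)) 1 1 : ℤ) : ZMod 37)) = 8 → χ β = 0 := by
    have h := Kneg 14 8 (-111) 32 (-15) 481 (by norm_num) (by norm_num) (by norm_num) (by norm_num)
      (by norm_num) 8 22 4 (by decide) (by decide) (by decide)
    exact h.2.2 k22 k4
  have k15 : ∀ β : Gamma0 37, (β : SL(2, ℤ)) 0 1 = -1 → ((((β : SL(2, ℤ)) 1 1 : ℤ) : ZMod 37)) = 15 → χ β = 0 := by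
    have h := Kneg 5 15 (-74) 6 (-6) 37 (by norm_num) (by norm_num) (by norm_num) (by norm_num)
      (by norm_num) 15 31 30 (by decide) (by decide) (by decide)
    exact h.2.2 k31 k30
  have k20 : ∀ β : Gamma0 37, (β : SL(2, ℤ)) 0 1 = -1 → ((((β : SL(2, ℤ)) 1 1 : ℤ) : ZMod 37)) = 20 → χ β = 0 := by
    have h := Kpos 30 21 (-629) 14 (-29) 407 (by norm_num) (by norm_num) (by norm_num) (by norm_num)
      (by norm_num) 21 8 20 (by decide) (by decide) (by decide)
    exact h.1 k21 k8
  have k23 : ∀ β : Gamma0 37, (β : SL(2, ℤ)) 0 1 = -1 → ((((β : SL(2, ℤ)) 1 1 : ℤ) : ZMod 37)) = 23 → χ β = 0 := by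
    have h := Kpos 29 23 (-666) 33 (-28) 925 (by norm_num) (by norm_num) (by norm_num) (by norm_num)
      (by norm_num) 23 9 22 (by decide) (by decide) (by decide)
    exact h.2.2 k9 k22
  have k24 : ∀ β : Gamma0 37, (β : SL(2, ℤ)) 0 1 = -1 → ((((β : SL(2, ℤ)) 1 1 : ℤ) : ZMod 37)) = 24 → χ β = 0 := by
    have h := Kpos 17 24 (-407) 30 (-16) 481 (by norm_num) (by norm_num) (by norm_num) (by norm_num)
      (by norm_num) 24 21 23 (by decide) (by decide) (by decide)
    exact h.2.2 k21 k23
  have k19 : ∀ β : Gamma0 37, (β : SL(2, ℤ)) 0 1 = -1 → ((((β : SL(2, ℤ)) 1 1 : ℤ) : ZMod 37)) = 19 → χ β = 0 := by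
    have h := Kneg 17 24 (-407) 2 (-18) 37 (by norm_num) (by norm_num) (by norm_num) (by norm_num)
      (by norm_num) 24 19 34 (by decide) (by decide) (by decide)
    exact h.2.1 k24 k34
  have k35 : ∀ β : Gamma0 37, (β : SL(2, ℤ)) 0 1 = -1 → ((((β : SL(2, ℤ)) 1 1 : ℤ) : ZMod 37)) = 35 → χ β = 0 := by
    have h := Kpos 3 25 (-74) 18 (-2) 37 (by norm_num) (by norm_num) (by norm_num) (by norm_num)
      (by norm_num) 25 35 24 (by decide) (by decide) (by decide)
    exact h.2.1 k25 k24
  have k29 : ∀ β : Gamma0 37, (β : SL(2, ℤ)) 0 1 = -1 → ((((β : SL(2, ℤ)) 1 1 : ℤ) : ZMod 37)) = 29 → χ β = 0 := by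
    have h := Kpos 23 29 (-666) 5 (-22) 111 (by norm_num) (by norm_num) (by norm_num) (by norm_num)
      (by norm_num) 29 15 28 (by decide) (by decide) (by decide)
    exact h.2.2 k15 k28
  have k13 : ∀ β : Gamma0 37, (β : SL(2, ℤ)) 0 1 = -1 → ((((β : SL(2, ℤ)) 1 1 : ℤ) : ZMod 37)) = 13 → χ β = 0 := by
    have h := Kneg 23 29 (-666) 20 (-24) 481 (by norm_num) (by norm_num) (by norm_num) (by norm_num)
      (by norm_num) 29 13 16 (by decide) (by decide) (by decide)
    exact h.2.1 k29 k16
  have k17 : ∀ β : Gamma0 37, (β : SL(2, ℤ)) 0 1 = -1 → ((((β : SL(2, ℤ)) 1 1 : ℤ) : ZMod 37)) = 17 → χ β = 0 := by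
    have h := Kpos 21 30 (-629) 24 (-20) 481 (by norm_num) (by norm_num) (by norm_num) (by norm_num)
      (by norm_num) 30 17 29 (by decide) (by decide) (by decide)
    exact h.2.1 k30 k29
  have k32 : ∀ β : Gamma0 37, (β : SL(2, ℤ)) 0 1 = -1 → ((((β : SL(2, ℤ)) 1 1 : ℤ) : ZMod 37)) = 32 → χ β = 0 := by
    have h := Kpos 6 31 (-185) 22 (-5) 111 (by norm_num) (by norm_num) (by norm_num) (by norm_num)
      (by norm_num) 31 32 30 (by decide) (by decide) (by decide)
    exact h.2.1 k31 k30
  have k14 : ∀ β : Gamma0 37, (β : SL(2, ℤ)) 0 1 = -1 → ((((β : SL(2, ℤ)) 1 1 : ℤ) : ZMod 37)) = 14 → χ β = 0 := by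
    have h := Kneg 22 32 (-703) 8 (-23) 185 (by norm_num) (by norm_num) (by norm_num) (by norm_num)
      (by norm_num) 32 14 28 (by decide) (by decide) (by decide)
    exact h.2.1 k32 k28
  have k18 : ∀ β : Gamma0 37, (β : SL(2, ℤ)) 0 1 = -1 → ((((β : SL(2, ℤ)) 1 1 : ℤ) : ZMod 37)) = 18 → χ β = 0 := by
    have h := Kneg 18 35 (-629) 35 (-19) 666 (by norm_num) (by norm_num) (by norm_num) (by norm_num)
      (by norm_num) 35 18 1 (by decide) (by decide) (by decide)
    exact h.2.1 k35 k1
  have k2 : ∀ β : Gamma0 37, (β : SL(2, ℤ)) 0 1 = -1 → ((((β : SL(2, ℤ)) 1 1 : ℤ) : ZMod 37)) = 2 → χ β = 0 := by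
    have h := Kpos 36 36 (-1295) 19 (-35) 666 (by norm_num) (by norm_num) (by norm_num) (by norm_num)
      (by norm_num) 36 2 35 (by decide) (by decide) (by decide)
    exact h.2.1 k36 k35
  have hcases : ∀ r : ZMod 37, r ≠ 0 →
      r = 1 ∨ r = 2 ∨ r = 3 ∨ r = 4 ∨ r = 5 ∨ r = 6 ∨ r = 7 ∨ r = 8 ∨ r = 9 ∨ r = 10 ∨ r = 11 ∨ r = 12 ∨ r = 13 ∨
      r = 14 ∨ r = 15 ∨ r = 16 ∨ r = 17 ∨ r = 18 ∨ r = 19 ∨ r = 20 ∨ r = 21 ∨ r = 22 ∨ r = 23 ∨ r = 24 ∨ r = 25 ∨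
      r = 26 ∨ r = 27 ∨ r = 28 ∨ r = 29 ∨ r = 30 ∨ r = 31 ∨ r = 32 ∨ r = 33 ∨ r = 34 ∨ r = 35 ∨ r = 36 := by
    decide
  have hB : ∀ β : Gamma0 37, (β : SL(2, ℤ)) 0 1 = -1 → χ β = 0 := by
    intro β hb
    haveI : Fact (1 < 37) := ⟨by norm_num⟩
    have hne : ((((β : SL(2, ℤ)) 1 1 : ℤ) : ZMod 37)) ≠ 0 := (isUnit_gamma0_apply_one_one β).ne_zero
    rcases hcases _ hne with h | h | h | h | h | h | h | h | h | h | h | h | h | h | h | h | h | h | h | h | h | h |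
      h | h | h | h | h | h | h | h | h | h | h | h | h | h
    · exact k1 β hb h
    · exact k2 β hb h
    · exact k3 β hb h
    · exact k4 β hb h
    · exact k5 β hb h
    · exact k6 β hb h
    · exact k7 β hb h
    · exact k8 β hb h
    · exact k9 β hb h
    · exact k10 β hb h
    · exact k11 β hb h
    · exact k12 β hb h
    · exact k13 β hb h
    · exact k14 β hb h
    · exact k15 β hb h
    · exact k16 β hb h
    · exact k17 β hb h
    · exact k18 β hb h
    · exact k19 β hb h
    · exact k20 β hb h
    · exact k21 β hb h
    · exact k22 β hb h
    · exact k23 β hb h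
    · exact k24 β hb h
    · exact k25 β hb h
    · exact k26 β hb h
    · exact k27 β hb h
    · exact k28 β hb h
    · exact k29 β hb h
    · exact k30 β hb h
    · exact k31 β hb h
    · exact k32 β hb h
    · exact k33 β hb h
    · exact k34 β hb h
    · exact k35 β hb h
    · exact k36 β hb h
  have hsucc : ∀ δ : ℤ, IsUnit ((δ : ℤ) : ZMod 37) ∨ IsUnit (((δ + 1 : ℤ)) : ZMod 37) := by
    simpa using isUnit_or_isUnit_succ_of_primePow (p := 37) (e := 1) (by norm_num)
  intro γ
  exact chi_eq_zero_of_forall_b1 hsucc hadd hsmall (forall_b1_of_forall_b_neg_one hadd hB) γ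


/-- **`CuspSpanEvenAtTwo 37`.** [cite: Pollack2003, Conj. 6.3] -/
theorem cuspSpanEvenAtTwo_thirtyseven : CuspSpanEvenAtTwo 37 :=
  cuspSpanEvenAtTwo_of_cuspSpanTrace cuspSpanTrace_thirtyseven

/-- **FLAT at conductors `29` and `37`**: every `W/ℚ` good supersingular at `2` with `a₂(W) = 0` and `N_W ∈ {29, 37}` has `2 ∤ L⁻`
for every Pollack pair of its newform at `2` (the named node at these levels + rtt-p4's `flatAtTwo_of_cuspSpanEvenAtTwo`).
BSD is not proved by this. [cite: Pollack2003, Conj. 6.3 and Prop. 6.18] -/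
theorem flatAtTwo_of_conductor_twentynine_or_thirtyseven {W : WeierstrassCurve ℚ} [W.IsElliptic] [W.IsGloballyMinimal]
    [NeZero (W.conductorNorm ℤ)] {f : CuspForm (Gamma0 (W.conductorNorm ℤ)) 2}
    (hf : IsNewformOf W f) (hss : GoodSS W 2) (ha : W.frobeniusTrace 2 = 0)
    (hN : W.conductorNorm ℤ = 29 ∨ W.conductorNorm ℤ = 37) :
    ∀ Lplus Lminus : IwasawaAlgebra 2, IsPollackPair f 2 Lplus Lminus → ¬ PowerSeries.C (2 : ℤ_[2]) ∣ Lminus := by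
  refine flatAtTwo_of_cuspSpanEvenAtTwo hf hss ha ?_
  have h29 := cuspSpanEvenAtTwo_twentynine
  have h37 := cuspSpanEvenAtTwo_thirtyseven
  revert h29 h37
  generalize W.conductorNorm ℤ = M at *
  rcases hN with rfl | rfl
  · exact fun h _ ↦ h
  · exact fun _ h ↦ h

end Summit.BirchSwinnertonDyer.BirchSwinnertonDyer.Theorems.SignedMuAtTwo

end
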